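import Summits.QuantumFields.YangMills.Theorems.BalabanUVNodesN15PerCubeGreenTwoGridKnitDefectReg335HolderSmall
import HarnessLib

/-!
# N15 = NE2, road (c) — PROGRAMME (PC), (PC-E-H): THE RATE ON THE HÖLDER DATUM — from ONE `Reg335HolderCube … ξ dist C β C_β` datum per cube and ONE smallness condition, the two-grid
# η-defect of the glued scalar covariant Green's functions is `≤ D·(1 + κ_e|m|·R(C, C_β, ξ, β, d))·(L^{−k∕4} + (2L^{−k})^β)·e^{−(δ∕16)dist}` — UNIFORM IN THE FINE SPACING `η′ = L^{−r}η` (every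
# `r ≥ 1`, same constants): the (PC-E) chain's rate on the series' Hölder-`β` per-cube regularity with NO factor `L^{r(1−β)}` (dag-n15-c g34, n15-c∕374)

Cell `pub-ymgap`, seat `pub-ymgap-dag-n15-c` (generation g34; R134 (a) seat, strategy s1 «first missing estimate»; HUMAN RULING D-0062; chair R424 venue).
`bears_on: R4∕N15 · K3⁸ SpineGivenEndpointR13SepCoPHV (stmt-QuantumFields-27366)`; filed `--kind proof --supports stmt-QuantumFields-27366 --as helper` — COUNT-NEUTRAL.
THREE theorems, 0 `def`, 0 `sorry`: `divergenceFitHolder_bookkeeping` (pure real algebra: the explicit `o_B^{H,expl}` of n15-c∕369∕371 is `≤ κ_e|m|·((2η)^β·R₁ + η·R₂)` with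
`R₁ = 4C_βξ^{−(2+β)}e^{5C∕ξ}`, `R₂ = (2(d+1)+2)(C∕ξ²)²e^{2C∕ξ} + 8(C∕ξ)(C∕ξ²)e^{2C∕ξ} + 8(C∕ξ)(C∕ξ²)e^{5C∕ξ}`, using `n_fη′ = 1`, `n_cNη′ = 1`, `Nη′ = η`, `(N−1)η′ ≤ η`, `η′ ≤ η ≤ 1` — NO dependence on
`N = L^r`) and ★★★ `uN_idef_scGreen_tr_of_reg335Holder_rate` (n15-c∕373 `…_small_explicit` + `η = L^{−k} ≤ L^{−k∕4}` (n15-c∕355 `inv_le_rpow_neg_quarter`) + `HasMaj.mono`) and ★★★★ `uN_idef_scGreen_tr_of_reg910_rate` — THE SAME ON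
THE PRINTED PER-CUBE CLASS `B11Reg910Classes.Reg910Cube` AS TYPED by dag-n07-a (β = β₀, C_β = C₄; n15-c∕370's bridge).  Imports BY NAME n15-c∕373 (through it 368–372 and dag-n07-a's
`B11Reg910Classes`); nothing in the tree is modified, no landed name re-declared.

WHAT THE (PC-E-H) CHAIN SAYS, FINAL FORM (n15-c∕368–374; MODEL two-grid setting of record: King tori `M L k m`, coarse field = straight fine holonomy, per-cube gauges, trace-form colour
coordinates `e`).  ∃ `δ, c₀ > 0`, `w₀`, `D ≥ 0` (depending on `d, L, a₀, ι` only) such that for every `k, r ≥ 1`, `L^{m_v} ≥ w₀`, every unitary-group valued fine bond field `U′` carrying on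
each cube's radius-5 collar ONE datum `Reg335HolderCube … ξ (η′·tdistT) C β C_β` ((3.35) of [B9] + the Hölder clause of [B11] Thm 1 (9) at exponent `β ≥ 0`, pairwise, η′-scale fine torus
distance) with `(1 + κ_e2√|m|√|m|)²(C∕ξ + C∕ξ²) ≤ c₀`, there are unitary cube gauges in which the two-grid η-defect of the glued scalar covariant Green's functions is
`≤ D(1 + κ_e|m|(R₁ + R₂))·(L^{−k∕4} + (2L^{−k})^β)·e^{−(δ∕16)dist}` — NO displayed two-grid input, NO fit parameter, and the SAME constants for every fine spacing `η′ = L^{−r}η`.  With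
dag-n07-a's typed `Reg910Cube` ([Balaban1985Variational] Thm 1 (9)–(10) per cube AS TYPED, any `β₀ > 0`) the datum holds at `β = β₀` with `C_β = C₄` (n15-c∕370 `Reg910Cube.reg335HolderCube`).

HONEST FRAMING ∕ LIMITS.  Bookkeeping; the datum is a HYPOTHESIS (production = node N04∕N07: [Balaban1985RegularSpaces] Thm 2 ∕ [Balaban1985Variational] Thm 1, NOT claimed); nothing of
[B9]∕[B11] asserted.  NE2⁺ NOT PRINTED ∕ NOT proved; N15 of record untouched (DISCHARGED AS CONSUMED, p687738); K3⁸ OPEN; counts of record UNMOVED (typed 28∕28 · discharged 8∕27); one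
finite 𝕋⁴ at fixed ε per index — NOT infinite volume, NOT OS on ℝ⁴, NOT a mass gap, NOT Clay.  Restate-immune (no Theses import).
-/

set_option autoImplicit false

noncomputable section

open scoped BigOperators Matrix Matrix.Norms.L2Operator
open Finset

namespace Summit.QuantumFields.YangMills.BalabanUVNodes.N15.Gluing

open Real
open Literature.MathematicalPhysics.QuantumFieldTheory.Balaban1983to89
open Literature.MathematicalPhysics.QuantumFieldTheory.Balaban1983to89.B5Prop11Plancherel (Tor fine unitVec)
open Literature.MathematicalPhysics.QuantumFieldTheory.Balaban1983to89.B11SectG (BlockNorm HasMaj)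
open Literature.MathematicalPhysics.QuantumFieldTheory.Balaban1983to89.T4EtaRateDefect (idef)
open Literature.MathematicalPhysics.QuantumFieldTheory.Balaban1983to89.B6UnitTorusCarrier (unitTorusGeo)
open Summit.QuantumFields.YangMills.BalabanUVNodes.N15.CurvedSpecies (Reg335HolderCube)
open Literature.MathematicalPhysics.QuantumFieldTheory.King1986 (aK)
open Literature.MathematicalPhysics.QuantumFieldTheory.King1986.Torus (tdistT)
open Literature.Barriers.QuantumFields (traceForm)
open Summit.QuantumFields.YangMills.BalabanUVNodes.N15.VectorPiece (kingPr)
open Summit.QuantumFields.YangMills.BalabanUVNodes.N15.MatrixSpecies (coordMat basisConst basisConst_nonneg liftBlk liftMap)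
open Summit.QuantumFields.YangMills.BalabanUVNodes.N15.CovAvg (mprod kingSec ctauS)

variable {d : ℕ}

/-! ## §1 Real bookkeeping -/

/-- REAL BOOKKEEPING (Hölder edition): the explicit divergence fit `o_B^{H,expl}` of n15-c∕369∕371 (letters `p = (C∕ξ)e^{η′C∕ξ}`, `q = (C∕ξ²)e^{η′C∕ξ}`,
`G = (C_βξ^{−(2+β)}(2Nη′)^β + 2η′(C∕ξ)(C∕ξ²))e^{5η′C∕ξ}`, `n_f = N·n_c`, `η = n_c⁻¹`, `η′ = n_f⁻¹`, `N ≥ 1`, `n_c ≥ 1`) is at most `κ·|m|·((2η)^β·R₁ + η·R₂)` with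
`R₁ = 4C_βξ^{−(2+β)}e^{5C∕ξ}`, `R₂ = (2(d+1)+2)(C∕ξ²)²e^{2C∕ξ} + 8(C∕ξ)(C∕ξ²)e^{2C∕ξ} + 8(C∕ξ)(C∕ξ²)e^{5C∕ξ}` — NO dependence on `N = L^r` (uniform in the fine spacing). [folklore] -/
theorem divergenceFitHolder_bookkeeping (κ m dd N Nm1 nc nf η η' p q G C Cβ ξ β : ℝ) (hκ : 0 ≤ κ) (hm : 0 ≤ m) (hdd : 0 ≤ dd) (hN1 : 1 ≤ N) (hNm1 : Nm1 ≤ N)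
    (hnc1 : 1 ≤ nc) (hnf : nf = N * nc) (hη : η = nc⁻¹) (hη' : η' = nf⁻¹) (hξ : 0 < ξ) (hC : 0 ≤ C) (hCβ : 0 ≤ Cβ)
    (hp : p = (C / ξ) * Real.exp (η' * (C / ξ))) (hq : q = (C / ξ ^ 2) * Real.exp (η' * (C / ξ)))
    (hG : G = (Cβ * (ξ ^ (2 + β))⁻¹ * (2 * N * η') ^ β + 2 * η' * ((C / ξ) * (C / ξ ^ 2))) * Real.exp (5 * (η' * (C / ξ)))) :
    κ * (nf ^ 2 * (m * (2 * (η' ^ 2 * G) + η' ^ 2 * q * (dd * (Nm1 * (η' ^ 2 * q))) + (η' ^ 2 * q + (dd * (Nm1 * (η' ^ 2 * q))) + η' ^ 2 * q) * (η' ^ 2 * q))) +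
        m * (2 * nc ^ 2 * (2 * N ^ 3 * ((η' * p) * (η' ^ 2 * q)) + N ^ 2 * (η' ^ 2 * G)) + 2 * (N * nc) ^ 2 * ((N + 1) * (η' * p) * (η' ^ 2 * q)))) ≤
      κ * m * ((2 * η) ^ β * (4 * Cβ * (ξ ^ (2 + β))⁻¹ * Real.exp (5 * (C / ξ))) +
        η * ((2 * dd + 2) * ((C / ξ ^ 2) ^ 2 * Real.exp (2 * (C / ξ))) + 8 * ((C / ξ) * (C / ξ ^ 2) * Real.exp (2 * (C / ξ))) + 8 * ((C / ξ) * (C / ξ ^ 2) * Real.exp (5 * (C / ξ))))) := by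
  have hN0 : 0 < N := by linarith
  have hnc0 : 0 < nc := by linarith
  have hnf0 : 0 < nf := by rw [hnf]; positivity
  have hη0 : 0 < η := by rw [hη]; positivity
  have hη'0 : 0 < η' := by rw [hη']; positivity
  have hη1 : η ≤ 1 := by rw [hη]; exact inv_le_one_of_one_le₀ hnc1
  have hnf1 : 1 ≤ nf := by rw [hnf]; exact one_le_mul_of_one_le_of_one_le hN1 hnc1
  have hη'1 : η' ≤ 1 := by rw [hη']; exact inv_le_one_of_one_le₀ hnf1
  have hη'η : η' ≤ η := by rw [hη', hη]; exact inv_anti₀ hnc0 (by rw [hnf]; exact le_mul_of_one_le_left hnc0.le hN1)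
  have hNη' : N * η' = η := by rw [hη', hη, hnf, mul_inv, ← mul_assoc, mul_inv_cancel₀ hN0.ne', one_mul]
  have hnfη' : nf * η' = 1 := by rw [hη', mul_inv_cancel₀ hnf0.ne']
  have hNncη' : N * nc * η' = 1 := by rw [← hnf]; exact hnfη'
  have hCξ : 0 ≤ C / ξ := div_nonneg hC hξ.le
  have hCξ2 : 0 ≤ C / ξ ^ 2 := by positivity
  have hp0 : 0 ≤ p := by rw [hp]; positivity
  have hq0 : 0 ≤ q := by rw [hq]; positivity
  -- step 1: the algebra of the scalings
  have hid : κ * (nf ^ 2 * (m * (2 * (η' ^ 2 * G) + η' ^ 2 * q * (dd * (Nm1 * (η' ^ 2 * q))) + (η' ^ 2 * q + (dd * (Nm1 * (η' ^ 2 * q))) + η' ^ 2 * q) * (η' ^ 2 * q))) +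
        m * (2 * nc ^ 2 * (2 * N ^ 3 * ((η' * p) * (η' ^ 2 * q)) + N ^ 2 * (η' ^ 2 * G)) + 2 * (N * nc) ^ 2 * ((N + 1) * (η' * p) * (η' ^ 2 * q)))) =
      κ * m * ((nf * η') ^ 2 * (2 * G + q * (dd * (Nm1 * (η' ^ 2 * q))) + (2 * (η' ^ 2 * q) + dd * (Nm1 * (η' ^ 2 * q))) * q) +
        (2 * (N * nc * η') ^ 2 * (2 * (N * η') * (p * q) + G) + 2 * (N * nc * η') ^ 2 * ((N + 1) * η' * (p * q)))) := by ring
  rw [hid, hnfη', hNncη', hNη']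
  simp only [one_pow, one_mul, mul_one]
  -- step 2: the sizes of the letters
  have hηC : η' * (C / ξ) ≤ C / ξ := mul_le_of_le_one_left hCξ hη'1
  have hexp5 : Real.exp (5 * (η' * (C / ξ))) ≤ Real.exp (5 * (C / ξ)) := Real.exp_le_exp.mpr (by linarith)
  have hE2 : Real.exp (η' * (C / ξ)) * Real.exp (η' * (C / ξ)) ≤ Real.exp (2 * (C / ξ)) := by
    rw [← Real.exp_add]; exact Real.exp_le_exp.mpr (by linarith)
  have hq2 : q ^ 2 ≤ (C / ξ ^ 2) ^ 2 * Real.exp (2 * (C / ξ)) := by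
    rw [hq]; calc ((C / ξ ^ 2) * Real.exp (η' * (C / ξ))) ^ 2 = (C / ξ ^ 2) ^ 2 * (Real.exp (η' * (C / ξ)) * Real.exp (η' * (C / ξ))) := by ring
      _ ≤ _ := mul_le_mul_of_nonneg_left hE2 (by positivity)
  have hpq : p * q ≤ (C / ξ) * (C / ξ ^ 2) * Real.exp (2 * (C / ξ)) := by
    rw [hp, hq]; calc (C / ξ) * Real.exp (η' * (C / ξ)) * ((C / ξ ^ 2) * Real.exp (η' * (C / ξ))) = (C / ξ) * (C / ξ ^ 2) * (Real.exp (η' * (C / ξ)) * Real.exp (η' * (C / ξ))) := by ring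
      _ ≤ _ := mul_le_mul_of_nonneg_left hE2 (by positivity)
  -- the Hölder letter: `(2Nη′)^β = (2η)^β`, `η′ ≤ η`, `e^{5η′C∕ξ} ≤ e^{5C∕ξ}`
  have hρ : 2 * N * η' = 2 * η := by rw [mul_assoc, hNη']
  have hρβ0 : 0 ≤ (2 * η) ^ β := Real.rpow_nonneg (by positivity) β
  have hξβ : 0 < (ξ ^ (2 + β))⁻¹ := inv_pos.mpr (Real.rpow_pos_of_pos hξ _)
  have hGle : G ≤ (2 * η) ^ β * (Cβ * (ξ ^ (2 + β))⁻¹ * Real.exp (5 * (C / ξ))) + η * (2 * ((C / ξ) * (C / ξ ^ 2) * Real.exp (5 * (C / ξ)))) := by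
    rw [hG, hρ]
    have h1 : (Cβ * (ξ ^ (2 + β))⁻¹ * (2 * η) ^ β + 2 * η' * ((C / ξ) * (C / ξ ^ 2))) * Real.exp (5 * (η' * (C / ξ))) ≤
        (Cβ * (ξ ^ (2 + β))⁻¹ * (2 * η) ^ β + 2 * η * ((C / ξ) * (C / ξ ^ 2))) * Real.exp (5 * (C / ξ)) := by
      refine mul_le_mul ?_ hexp5 (Real.exp_pos _).le (by positivity)
      have : 2 * η' * ((C / ξ) * (C / ξ ^ 2)) ≤ 2 * η * ((C / ξ) * (C / ξ ^ 2)) := by gcongr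
      linarith
    refine h1.trans (le_of_eq ?_)
    ring
  have hG0 : 0 ≤ G := by rw [hG]; have : 0 ≤ (2 * N * η') ^ β := Real.rpow_nonneg (by positivity) β; positivity
  -- step 3: assemble (no `set`: the letters written out)
  have hκm : 0 ≤ κ * m := mul_nonneg hκ hm
  have hR20 : 0 ≤ ((C / ξ ^ 2) ^ 2 * Real.exp (2 * (C / ξ))) := by positivity
  have hNm1η' : Nm1 * η' ≤ η := (mul_le_mul_of_nonneg_right hNm1 hη'0.le).trans hNη'.le
  have hη'2 : η' ^ 2 ≤ η := by nlinarith only [hη'1, hη'η, hη'0.le]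
  have hNη1 : (Nm1 * η') * η' ≤ η := by
    have h1 : (Nm1 * η') * η' ≤ η * 1 := mul_le_mul hNm1η' hη'1 hη'0.le hη0.le
    rwa [mul_one] at h1
  -- `q·(dd·Nm1·η′²·q) ≤ dd·η·q²`
  have hA2 : q * (dd * (Nm1 * (η' ^ 2 * q))) ≤ dd * η * ((C / ξ ^ 2) ^ 2 * Real.exp (2 * (C / ξ))) := by
    have e : q * (dd * (Nm1 * (η' ^ 2 * q))) = dd * ((Nm1 * η') * η') * q ^ 2 := by ring
    rw [e]
    calc dd * ((Nm1 * η') * η') * q ^ 2 ≤ dd * η * q ^ 2 := by gcongr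
      _ ≤ dd * η * ((C / ξ ^ 2) ^ 2 * Real.exp (2 * (C / ξ))) := mul_le_mul_of_nonneg_left hq2 (by positivity)
  -- `(2η′²q + dd·Nm1·η′²·q)·q ≤ (2 + dd)·η·q²`
  have hA3 : (2 * (η' ^ 2 * q) + dd * (Nm1 * (η' ^ 2 * q))) * q ≤ (2 + dd) * η * ((C / ξ ^ 2) ^ 2 * Real.exp (2 * (C / ξ))) := by
    have e : (2 * (η' ^ 2 * q) + dd * (Nm1 * (η' ^ 2 * q))) * q = (2 * η' ^ 2 + dd * ((Nm1 * η') * η')) * q ^ 2 := by ring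
    rw [e]
    have h2 : 2 * η' ^ 2 + dd * ((Nm1 * η') * η') ≤ (2 + dd) * η := by nlinarith only [hη'2, hNη1, hdd]
    calc (2 * η' ^ 2 + dd * ((Nm1 * η') * η')) * q ^ 2 ≤ ((2 + dd) * η) * q ^ 2 := mul_le_mul_of_nonneg_right h2 (sq_nonneg _)
      _ ≤ ((2 + dd) * η) * ((C / ξ ^ 2) ^ 2 * Real.exp (2 * (C / ξ))) := mul_le_mul_of_nonneg_left hq2 (by positivity)
      _ = (2 + dd) * η * ((C / ξ ^ 2) ^ 2 * Real.exp (2 * (C / ξ))) := by ring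
  have hB1 : 2 * (2 * η * (p * q) + G) ≤ 4 * η * ((C / ξ) * (C / ξ ^ 2) * Real.exp (2 * (C / ξ))) + 2 * ((2 * η) ^ β * (Cβ * (ξ ^ (2 + β))⁻¹ * Real.exp (5 * (C / ξ))) + η * (2 * ((C / ξ) * (C / ξ ^ 2) * Real.exp (5 * (C / ξ))))) := by
    have h1 : 2 * η * (p * q) ≤ 2 * η * ((C / ξ) * (C / ξ ^ 2) * Real.exp (2 * (C / ξ))) := mul_le_mul_of_nonneg_left hpq (by positivity)
    linarith
  have hB3 : 2 * ((N + 1) * η' * (p * q)) ≤ 4 * η * ((C / ξ) * (C / ξ ^ 2) * Real.exp (2 * (C / ξ))) := by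
    have h3a : (N + 1) * η' ≤ 2 * η := by linarith [hNη', hη'η]
    calc 2 * ((N + 1) * η' * (p * q)) ≤ 2 * (2 * η * (p * q)) := by linarith [mul_le_mul_of_nonneg_right h3a (mul_nonneg hp0 hq0)]
      _ ≤ 2 * (2 * η * ((C / ξ) * (C / ξ ^ 2) * Real.exp (2 * (C / ξ)))) := by gcongr
      _ = 4 * η * ((C / ξ) * (C / ξ ^ 2) * Real.exp (2 * (C / ξ))) := by ring
  have hG2 : 2 * G ≤ 2 * ((2 * η) ^ β * (Cβ * (ξ ^ (2 + β))⁻¹ * Real.exp (5 * (C / ξ))) + η * (2 * ((C / ξ) * (C / ξ ^ 2) * Real.exp (5 * (C / ξ))))) := by linarith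
  calc κ * m * (2 * G + q * (dd * (Nm1 * (η' ^ 2 * q))) + (2 * (η' ^ 2 * q) + dd * (Nm1 * (η' ^ 2 * q))) * q + (2 * (2 * η * (p * q) + G) + 2 * ((N + 1) * η' * (p * q))))
      ≤ κ * m * (2 * ((2 * η) ^ β * (Cβ * (ξ ^ (2 + β))⁻¹ * Real.exp (5 * (C / ξ))) + η * (2 * ((C / ξ) * (C / ξ ^ 2) * Real.exp (5 * (C / ξ))))) + dd * η * ((C / ξ ^ 2) ^ 2 * Real.exp (2 * (C / ξ))) + (2 + dd) * η * ((C / ξ ^ 2) ^ 2 * Real.exp (2 * (C / ξ))) + ((4 * η * ((C / ξ) * (C / ξ ^ 2) * Real.exp (2 * (C / ξ))) + 2 * ((2 * η) ^ β * (Cβ * (ξ ^ (2 + β))⁻¹ * Real.exp (5 * (C / ξ))) + η * (2 * ((C / ξ) * (C / ξ ^ 2) * Real.exp (5 * (C / ξ)))))) + 4 * η * ((C / ξ) * (C / ξ ^ 2) * Real.exp (2 * (C / ξ))))) :=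
        mul_le_mul_of_nonneg_left (add_le_add (add_le_add (add_le_add hG2 hA2) hA3) (add_le_add hB1 hB3)) hκm
    _ = _ := by ring


/-! ## §2 The rate, uniform in the fine spacing -/

section Rate

variable {L : ℕ} [NeZero L]

set_option maxHeartbeats 800000 in
/-- ★★★ **THE (PC-E-H) CHAIN's RATE, UNIFORM IN THE FINE SPACING** — see the module docstring. [cite: Balaban1985BackgroundPropagators, (3.35) p.396, (3.40) p.397, (3.51)–(3.52) p.400 (shapes);
Balaban1985Variational, Thm 1 (9) p.279 (the per-cube Hölder clause, read pairwise); Balaban1985RegularSpaces, Thm 2 (1.36) p.82 (β ≤ β₀ < 1 as proved); King1986, Lemma 4.5 (4.38) p.674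
(the A = 0 template, uniform in n), p.664 (pairing)] -/
theorem uN_idef_scGreen_tr_of_reg335Holder_rate (hL : Odd L ∧ 1 < L) (hL7 : 7 ≤ L) {a₀ : ℝ} (ha₀ : 0 < a₀) (ι : Type) [Fintype ι] [DecidableEq ι] :
    ∃ δ w₀ c₀ D : ℝ, 0 < δ ∧ 0 < c₀ ∧ 0 ≤ D ∧ ∀ (mv kk r : ℕ), 1 ≤ kk → 1 ≤ r → w₀ ≤ ((L ^ mv : ℕ) : ℝ) →
      ∀ {mm : Type} [Fintype mm] [DecidableEq mm] [Nonempty mm] (e : Matrix mm mm ℂ ≃L[ℝ] (ι → ℝ)), (∀ A B : Matrix mm mm ℂ, traceForm A B = e A ⬝ᵥ e B) →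
      ∀ (U' : Fin (d + 1) → ScX' d L mv kk r hL → (Matrix mm mm ℂ)ˣ), (∀ μ x', (U' μ x' : Matrix mm mm ℂ) ∈ Matrix.unitaryGroup mm ℂ) →
      ∀ (Q : (Fin (d + 1) → ZMod (2 * L)) → Set (ScX' d L mv kk r hL)) (ξ C β Cβ : ℝ), 0 < ξ → 0 ≤ C → 0 ≤ β → 0 ≤ Cβ →
        (1 + @basisConst ι _ (Matrix mm mm ℂ) Matrix.frobeniusNormedAddCommGroup Matrix.frobeniusNormedSpace e * (2 * Real.sqrt (Fintype.card mm)) * Real.sqrt (Fintype.card mm)) ^ 2 * (C / ξ + C / ξ ^ 2) ≤ c₀ →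
        (∀ k, Reg335HolderCube (scShift' d L mv kk r hL) U' ((((L ^ r * L ^ kk : ℕ) : ℝ))⁻¹) (Q k) ξ (fun z z' => ((((L ^ r * L ^ kk : ℕ) : ℝ))⁻¹) * tdistT (fine (L ^ r * L ^ kk) (cvM d L mv kk hL)) z z') C β Cβ) →
        (∀ k z, (∃ y ∈ cvSk d L mv kk hL k, (unitTorusGeo L kk (cvM d L mv kk hL)).dist (scBlk' d L mv kk r hL z) y ≤ 5) → z ∈ Q k) →
      ∃ u' : (Fin (d + 1) → ZMod (2 * L)) → ScX' d L mv kk r hL → Matrix mm mm ℂ, (∀ k x', (u' k x')ᴴ * u' k x' = 1) ∧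
       (
        HasMaj (ScNorm d L mv kk hL ι) (BlockNorm.ofBlocks (unitTorusGeo L kk (cvM d L mv kk hL)) (liftBlk (scBlk d L mv kk hL ∘ kingPr L kk r (cvM d L mv kk hL)) ι))
          (idef (ctauS (cvM d L mv kk hL) L kk r (fun μ x' => coordMat e (ContinuousLinearMap.mulLeftRight ℝ (Matrix mm mm ℂ) ((U' μ x' : Matrix mm mm ℂ)) ((U' μ x' : Matrix mm mm ℂ))ᴴ))) (ctauS (cvM d L mv kk hL) L kk r (fun μ x' => coordMat e (ContinuousLinearMap.mulLeftRight ℝ (Matrix mm mm ℂ) ((U' μ x' : Matrix mm mm ℂ)) ((U' μ x' : Matrix mm mm ℂ))ᴴ))) (scGlued' d L mv kk r hL (aK a₀ (L : ℝ) (r + kk) * (((L ^ r * L ^ kk : ℕ) : ℝ)) ^ (d + 1)) ((((L ^ r * L ^ kk : ℕ) : ℝ))⁻¹) ι e u' (fun μ z => (U' μ z : Matrix mm mm ℂ)) (scP' d L mv kk r hL (aK a₀ (L : ℝ) (r + kk) * (((L ^ r * L ^ kk : ℕ) : ℝ)) ^ (d + 1)) ι e (fun μ z => (U' μ z : Matrix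 mm mm ℂ))) (scNV' d L mv kk r hL (aK a₀ (L : ℝ) (r + kk) * (((L ^ r * L ^ kk : ℕ) : ℝ)) ^ (d + 1)) ι e u' (fun μ z => (U' μ z : Matrix mm mm ℂ)))) (scGlued d L mv kk hL (aK a₀ (L : ℝ) kk * (((L ^ kk : ℕ) : ℝ)) ^ (d + 1)) ((((L ^ kk : ℕ) : ℝ))⁻¹) ι e (fun k x => u' k (kingSec (cvM d L mv kk hL) L kk r x)) (fun μ y => mprod (fun t => (U' μ (kingSec (cvM d L mv kk hL) L kk r y + t • unitVec (fine (L ^ r * L ^ kk) (cvM d L mv kk hL)) μ) : Matrix mm mm ℂ)) (L ^ r)) (scP d L mv kk hL (aK a₀ (L : ℝ) kk * (((L ^ kk : ℕ) : ℝ)) ^ (d + 1)) ι e (fun μ y => mprod (fun t => (U' μ (kingSec (cvM d L mv kk hL) L kk r y + t • unitVec (fine (L ^ r * L ^ kk) (cvM d L mv kk hL)) μ) : Matrix mm mm ℂ)) (L ^ r))) (scNV d L mv kk hL (aK a₀ (L : ℝ) kk * (((L ^ kk : ℕ) : ℝ)) ^ (d + 1)) ι e (fun k x => u' k (kingSec (cvM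 d L mv kk hL) L kk r x)) (fun μ y => mprod (fun t => (U' μ (kingSec (cvM d L mv kk hL) L kk r y + t • unitVec (fine (L ^ r * L ^ kk) (cvM d L mv kk hL)) μ) : Matrix mm mm ℂ)) (L ^ r)))))
          (fun y y' => D * (1 + @basisConst ι _ (Matrix mm mm ℂ) Matrix.frobeniusNormedAddCommGroup Matrix.frobeniusNormedSpace e * Fintype.card mm * ((4 * Cβ * (ξ ^ (2 + β))⁻¹ * Real.exp (5 * (C / ξ))) + ((2 * ((d + 1 : ℕ) : ℝ) + 2) * ((C / ξ ^ 2) ^ 2 * Real.exp (2 * (C / ξ))) + 8 * ((C / ξ) * (C / ξ ^ 2) * Real.exp (2 * (C / ξ))) + 8 * ((C / ξ) * (C / ξ ^ 2) * Real.exp (5 * (C / ξ)))))) * (((L : ℝ) ^ kk) ^ (-(1 / 4 : ℝ)) + (2 * ((((L ^ kk : ℕ) : ℝ))⁻¹)) ^ β) * Real.exp (-(δ / 16 * (unitTorusGeo L kk (cvM d L mv kk hL)).dist y y')))) := by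
  obtain ⟨δ, w₀, c₀, D, hδ, hc₀, H⟩ := uN_idef_scGreen_tr_of_reg335Holder_small_explicit (d := d) hL hL7 ha₀ ι
  have hLpos : 0 < L := (by have := hL.2; omega)
  have hL1r : (1 : ℝ) < (L : ℝ) := by exact_mod_cast hL.2
  refine ⟨δ, w₀, c₀, max D 0, hδ, hc₀, le_max_right _ _, fun mv kk r hk hr hw₀ => ?_⟩
  intro mm _ _ _ e he U' hU'g Q ξ C β Cβ hξ hC hβ hCβ hsmall h335 hQ
  obtain ⟨u', hu', hmain⟩ := H mv kk r hk hr hw₀ e he U' hU'g Q ξ C β Cβ hξ hC hβ hCβ hsmall h335 hQ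
  refine ⟨u', hu', hmain.mono fun y y' => ?_⟩
  have hκ := @basisConst_nonneg ι _ (Matrix mm mm ℂ) Matrix.frobeniusNormedAddCommGroup Matrix.frobeniusNormedSpace e
  have hx1 : (1 : ℝ) ≤ (L : ℝ) ^ kk := one_le_pow₀ hL1r.le
  have hηx : ((((L ^ kk : ℕ) : ℝ))⁻¹) ≤ ((L : ℝ) ^ kk) ^ (-(1 / 4 : ℝ)) := by rw [Nat.cast_pow]; exact (inv_le_rpow_neg_quarter hx1).1
  have hx0 : (0 : ℝ) ≤ ((L : ℝ) ^ kk) ^ (-(1 / 4 : ℝ)) := by positivity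
  have hxβ0 : (0 : ℝ) ≤ (2 * ((((L ^ kk : ℕ) : ℝ))⁻¹)) ^ β := Real.rpow_nonneg (by positivity) β
  have hoB := divergenceFitHolder_bookkeeping (@basisConst ι _ (Matrix mm mm ℂ) Matrix.frobeniusNormedAddCommGroup Matrix.frobeniusNormedSpace e) (Fintype.card mm : ℝ) ((d + 1 : ℕ) : ℝ) ((L ^ r : ℕ) : ℝ) ((L ^ r - 1 : ℕ) : ℝ) ((L ^ kk : ℕ) : ℝ) ((L ^ r * L ^ kk : ℕ) : ℝ)
    ((((L ^ kk : ℕ) : ℝ))⁻¹) ((((L ^ r * L ^ kk : ℕ) : ℝ))⁻¹) ((C / ξ) * Real.exp (((((L ^ r * L ^ kk : ℕ) : ℝ))⁻¹) * (C / ξ))) ((C / ξ ^ 2) * Real.exp (((((L ^ r * L ^ kk : ℕ) : ℝ))⁻¹) * (C / ξ))) ((Cβ * (ξ ^ (2 + β))⁻¹ * (2 * ((L ^ r : ℕ) : ℝ) * ((((L ^ r * L ^ kk : ℕ) : ℝ))⁻¹)) ^ β + 2 * ((((L ^ r * L ^ kk : ℕ) : ℝ))⁻¹) * ((C / ξ)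 * (C / ξ ^ 2))) * Real.exp (5 * (((((L ^ r * L ^ kk : ℕ) : ℝ))⁻¹) * (C / ξ)))) C Cβ ξ β hκ (Nat.cast_nonneg _) (Nat.cast_nonneg _)
    (by exact_mod_cast Nat.one_le_pow _ _ hLpos) (by exact_mod_cast Nat.sub_le _ _) (by exact_mod_cast Nat.one_le_pow _ _ hLpos) (by rw [Nat.cast_mul]) rfl rfl hξ hC hCβ rfl rfl rfl
  have hR0 : (0 : ℝ) ≤ (4 * Cβ * (ξ ^ (2 + β))⁻¹ * Real.exp (5 * (C / ξ))) + ((2 * ((d + 1 : ℕ) : ℝ) + 2) * ((C / ξ ^ 2) ^ 2 * Real.exp (2 * (C / ξ))) + 8 * ((C / ξ) * (C / ξ ^ 2) * Real.exp (2 * (C / ξ))) + 8 * ((C / ξ) * (C / ξ ^ 2) * Real.exp (5 * (C / ξ)))) := by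
    have : (0 : ℝ) < ξ ^ (2 + β) := Real.rpow_pos_of_pos hξ _
    positivity
  have hoB0 : (0 : ℝ) ≤ (@basisConst ι _ (Matrix mm mm ℂ) Matrix.frobeniusNormedAddCommGroup Matrix.frobeniusNormedSpace e * (((L ^ r * L ^ kk : ℕ) : ℝ) ^ 2 * (Fintype.card mm * (2 * (((((L ^ r * L ^ kk : ℕ) : ℝ))⁻¹) ^ 2 * ((Cβ * (ξ ^ (2 + β))⁻¹ * (2 * ((L ^ r : ℕ) : ℝ) * ((((L ^ r * L ^ kk : ℕ) : ℝ))⁻¹)) ^ β + 2 * ((((L ^ r * L ^ kk : ℕ) : ℝ))⁻¹) * ((C / ξ) * (C / ξ ^ 2))) * Real.exp (5 * (((((L ^ r * L ^ kk : ℕ) : ℝ))⁻¹) * (C / ξ))))) + ((((L ^ r * L ^ kk : ℕ) : ℝ))⁻¹) ^ 2 * ((C / ξ ^ 2) * Real.exp (((((L ^ r * L ^ kk : ℕ) : ℝ))⁻¹) * (C / ξ))) * (((d + 1 : ℕ) : ℝ) * (((L ^ r - 1 : ℕ) : ℝ) * (((((L ^ r * L ^ kk : ℕ) : ℝ))⁻¹)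 ^ 2 * ((C / ξ ^ 2) * Real.exp (((((L ^ r * L ^ kk : ℕ) : ℝ))⁻¹) * (C / ξ)))))) + (((((L ^ r * L ^ kk : ℕ) : ℝ))⁻¹) ^ 2 * ((C / ξ ^ 2) * Real.exp (((((L ^ r * L ^ kk : ℕ) : ℝ))⁻¹) * (C / ξ))) + (((d + 1 : ℕ) : ℝ) * (((L ^ r - 1 : ℕ) : ℝ) * (((((L ^ r * L ^ kk : ℕ) : ℝ))⁻¹) ^ 2 * ((C / ξ ^ 2) * Real.exp (((((L ^ r * L ^ kk : ℕ) : ℝ))⁻¹) * (C / ξ)))))) + ((((L ^ r * L ^ kk : ℕ) : ℝ))⁻¹) ^ 2 * ((C / ξ ^ 2) * Real.exp (((((L ^ r * L ^ kk : ℕ) : ℝ))⁻¹) * (C / ξ)))) * (((((L ^ r * L ^ kk : ℕ) : ℝ))⁻¹) ^ 2 * ((C / ξ ^ 2) * Real.exp (((((L ^ r * L ^ kk : ℕ) : ℝ))⁻¹) * (C / ξ)))))) + Fintype.card mm * (2 * ((L ^ kk : ℕ) : ℝ) ^ 2 * (2 * ((L ^ r : ℕ) : ℝ) ^ 3 * ((((((L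 ^ r * L ^ kk : ℕ) : ℝ))⁻¹) * ((C / ξ) * Real.exp (((((L ^ r * L ^ kk : ℕ) : ℝ))⁻¹) * (C / ξ)))) * (((((L ^ r * L ^ kk : ℕ) : ℝ))⁻¹) ^ 2 * ((C / ξ ^ 2) * Real.exp (((((L ^ r * L ^ kk : ℕ) : ℝ))⁻¹) * (C / ξ))))) + ((L ^ r : ℕ) : ℝ) ^ 2 * (((((L ^ r * L ^ kk : ℕ) : ℝ))⁻¹) ^ 2 * ((Cβ * (ξ ^ (2 + β))⁻¹ * (2 * ((L ^ r : ℕ) : ℝ) * ((((L ^ r * L ^ kk : ℕ) : ℝ))⁻¹)) ^ β + 2 * ((((L ^ r * L ^ kk : ℕ) : ℝ))⁻¹) * ((C / ξ) * (C / ξ ^ 2))) * Real.exp (5 * (((((L ^ r * L ^ kk : ℕ) : ℝ))⁻¹) * (C / ξ)))))) + 2 * (((L ^ r : ℕ) : ℝ) * ((L ^ kk : ℕ) : ℝ)) ^ 2 * ((((L ^ r : ℕ) : ℝ) + 1) * (((((L ^ r * L ^ kk : ℕ) : ℝ))⁻¹) * ((C / ξ) * Real.exp (((((L ^ r * L ^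 kk : ℕ) : ℝ))⁻¹) * (C / ξ)))) * (((((L ^ r * L ^ kk : ℕ) : ℝ))⁻¹) ^ 2 * ((C / ξ ^ 2) * Real.exp (((((L ^ r * L ^ kk : ℕ) : ℝ))⁻¹) * (C / ξ)))))))) := by
    have : (0 : ℝ) ≤ (2 * ((L ^ r : ℕ) : ℝ) * ((((L ^ r * L ^ kk : ℕ) : ℝ))⁻¹)) ^ β := Real.rpow_nonneg (by positivity) β
    have : (0 : ℝ) < ξ ^ (2 + β) := Real.rpow_pos_of_pos hξ _
    positivity
  -- `κ|m|((2η)^β R₁ + η R₂) ≤ κ|m|(R₁ + R₂)·(x14 + (2η)^β)`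
  have hR10 : (0 : ℝ) ≤ (4 * Cβ * (ξ ^ (2 + β))⁻¹ * Real.exp (5 * (C / ξ))) := by have : (0 : ℝ) < ξ ^ (2 + β) := Real.rpow_pos_of_pos hξ _; positivity
  have hR20 : (0 : ℝ) ≤ ((2 * ((d + 1 : ℕ) : ℝ) + 2) * ((C / ξ ^ 2) ^ 2 * Real.exp (2 * (C / ξ))) + 8 * ((C / ξ) * (C / ξ ^ 2) * Real.exp (2 * (C / ξ))) + 8 * ((C / ξ) * (C / ξ ^ 2) * Real.exp (5 * (C / ξ)))) := by positivity
  have h2 : (@basisConst ι _ (Matrix mm mm ℂ) Matrix.frobeniusNormedAddCommGroup Matrix.frobeniusNormedSpace e * (((L ^ r * L ^ kk : ℕ) : ℝ) ^ 2 * (Fintype.card mm * (2 * (((((L ^ r * L ^ kk : ℕ) : ℝ))⁻¹) ^ 2 * ((Cβ * (ξ ^ (2 + β))⁻¹ * (2 * ((L ^ r : ℕ) : ℝ) * ((((L ^ r * L ^ kk : ℕ) : ℝ))⁻¹)) ^ β + 2 * ((((L ^ r * L ^ kk : ℕ) : ℝ))⁻¹) * ((C / ξ) * (C / ξ ^ 2)))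 * Real.exp (5 * (((((L ^ r * L ^ kk : ℕ) : ℝ))⁻¹) * (C / ξ))))) + ((((L ^ r * L ^ kk : ℕ) : ℝ))⁻¹) ^ 2 * ((C / ξ ^ 2) * Real.exp (((((L ^ r * L ^ kk : ℕ) : ℝ))⁻¹) * (C / ξ))) * (((d + 1 : ℕ) : ℝ) * (((L ^ r - 1 : ℕ) : ℝ) * (((((L ^ r * L ^ kk : ℕ) : ℝ))⁻¹) ^ 2 * ((C / ξ ^ 2) * Real.exp (((((L ^ r * L ^ kk : ℕ) : ℝ))⁻¹) * (C / ξ)))))) + (((((L ^ r * L ^ kk : ℕ) : ℝ))⁻¹) ^ 2 * ((C / ξ ^ 2) * Real.exp (((((L ^ r * L ^ kk : ℕ) : ℝ))⁻¹) * (C / ξ))) + (((d + 1 : ℕ) : ℝ) * (((L ^ r - 1 : ℕ) : ℝ) * (((((L ^ r * L ^ kk : ℕ) : ℝ))⁻¹) ^ 2 * ((C / ξ ^ 2) * Real.exp (((((L ^ r * L ^ kk : ℕ) : ℝ))⁻¹) * (C / ξ)))))) + ((((L ^ r * L ^ kk : ℕ) : ℝ))⁻¹) ^ 2 * ((C / ξ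 ^ 2) * Real.exp (((((L ^ r * L ^ kk : ℕ) : ℝ))⁻¹) * (C / ξ)))) * (((((L ^ r * L ^ kk : ℕ) : ℝ))⁻¹) ^ 2 * ((C / ξ ^ 2) * Real.exp (((((L ^ r * L ^ kk : ℕ) : ℝ))⁻¹) * (C / ξ)))))) + Fintype.card mm * (2 * ((L ^ kk : ℕ) : ℝ) ^ 2 * (2 * ((L ^ r : ℕ) : ℝ) ^ 3 * ((((((L ^ r * L ^ kk : ℕ) : ℝ))⁻¹) * ((C / ξ) * Real.exp (((((L ^ r * L ^ kk : ℕ) : ℝ))⁻¹) * (C / ξ)))) * (((((L ^ r * L ^ kk : ℕ) : ℝ))⁻¹) ^ 2 * ((C / ξ ^ 2) * Real.exp (((((L ^ r * L ^ kk : ℕ) : ℝ))⁻¹) * (C / ξ))))) + ((L ^ r : ℕ) : ℝ) ^ 2 * (((((L ^ r * L ^ kk : ℕ) : ℝ))⁻¹) ^ 2 * ((Cβ * (ξ ^ (2 + β))⁻¹ * (2 * ((L ^ r : ℕ) : ℝ) * ((((L ^ r * L ^ kk : ℕ) : ℝ))⁻¹)) ^ β + 2 * ((((L ^ r * L ^ kk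 : ℕ) : ℝ))⁻¹) * ((C / ξ) * (C / ξ ^ 2))) * Real.exp (5 * (((((L ^ r * L ^ kk : ℕ) : ℝ))⁻¹) * (C / ξ)))))) + 2 * (((L ^ r : ℕ) : ℝ) * ((L ^ kk : ℕ) : ℝ)) ^ 2 * ((((L ^ r : ℕ) : ℝ) + 1) * (((((L ^ r * L ^ kk : ℕ) : ℝ))⁻¹) * ((C / ξ) * Real.exp (((((L ^ r * L ^ kk : ℕ) : ℝ))⁻¹) * (C / ξ)))) * (((((L ^ r * L ^ kk : ℕ) : ℝ))⁻¹) ^ 2 * ((C / ξ ^ 2) * Real.exp (((((L ^ r * L ^ kk : ℕ) : ℝ))⁻¹) * (C / ξ)))))))) ≤ @basisConst ι _ (Matrix mm mm ℂ) Matrix.frobeniusNormedAddCommGroup Matrix.frobeniusNormedSpace e * Fintype.card mm * ((4 * Cβ * (ξ ^ (2 + β))⁻¹ * Real.exp (5 * (C / ξ))) + ((2 * ((d + 1 : ℕ) : ℝ) + 2) * ((C / ξ ^ 2) ^ 2 * Real.exp (2 * (C / ξ))) + 8 * ((C / ξ) * (C / ξ ^ 2) * Real.exp (2 * (C / ξ)))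 + 8 * ((C / ξ) * (C / ξ ^ 2) * Real.exp (5 * (C / ξ))))) * (((L : ℝ) ^ kk) ^ (-(1 / 4 : ℝ)) + (2 * ((((L ^ kk : ℕ) : ℝ))⁻¹)) ^ β) := by
    refine hoB.trans ?_
    have hκm : 0 ≤ @basisConst ι _ (Matrix mm mm ℂ) Matrix.frobeniusNormedAddCommGroup Matrix.frobeniusNormedSpace e * (Fintype.card mm : ℝ) := mul_nonneg hκ (Nat.cast_nonneg _)
    have ha : (2 * ((((L ^ kk : ℕ) : ℝ))⁻¹)) ^ β * (4 * Cβ * (ξ ^ (2 + β))⁻¹ * Real.exp (5 * (C / ξ))) ≤ (4 * Cβ * (ξ ^ (2 + β))⁻¹ * Real.exp (5 * (C / ξ))) * (((L : ℝ) ^ kk) ^ (-(1 / 4 : ℝ)) + (2 * ((((L ^ kk : ℕ) : ℝ))⁻¹)) ^ β) := by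
      rw [mul_comm]; exact mul_le_mul_of_nonneg_left (le_add_of_nonneg_left hx0) hR10
    have hb : ((((L ^ kk : ℕ) : ℝ))⁻¹) * ((2 * ((d + 1 : ℕ) : ℝ) + 2) * ((C / ξ ^ 2) ^ 2 * Real.exp (2 * (C / ξ))) + 8 * ((C / ξ) * (C / ξ ^ 2) * Real.exp (2 * (C / ξ))) + 8 * ((C / ξ) * (C / ξ ^ 2) * Real.exp (5 * (C / ξ)))) ≤ ((2 * ((d + 1 : ℕ) : ℝ) + 2) * ((C / ξ ^ 2) ^ 2 * Real.exp (2 * (C / ξ))) + 8 * ((C / ξ) * (C / ξ ^ 2) * Real.exp (2 * (C / ξ))) + 8 * ((C / ξ) * (C / ξ ^ 2) * Real.exp (5 * (C / ξ)))) * (((L : ℝ) ^ kk) ^ (-(1 / 4 : ℝ)) + (2 * ((((L ^ kk : ℕ) : ℝ))⁻¹)) ^ β) := by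
      rw [mul_comm]; exact mul_le_mul_of_nonneg_left (hηx.trans (le_add_of_nonneg_right hxβ0)) hR20
    calc @basisConst ι _ (Matrix mm mm ℂ) Matrix.frobeniusNormedAddCommGroup Matrix.frobeniusNormedSpace e * Fintype.card mm * ((2 * ((((L ^ kk : ℕ) : ℝ))⁻¹)) ^ β * (4 * Cβ * (ξ ^ (2 + β))⁻¹ * Real.exp (5 * (C / ξ))) + ((((L ^ kk : ℕ) : ℝ))⁻¹) * ((2 * ((d + 1 : ℕ) : ℝ) + 2) * ((C / ξ ^ 2) ^ 2 * Real.exp (2 * (C / ξ))) + 8 * ((C / ξ) * (C / ξ ^ 2) * Real.exp (2 * (C / ξ))) + 8 * ((C / ξ) * (C / ξ ^ 2) * Real.exp (5 * (C / ξ)))))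
        ≤ @basisConst ι _ (Matrix mm mm ℂ) Matrix.frobeniusNormedAddCommGroup Matrix.frobeniusNormedSpace e * Fintype.card mm * ((4 * Cβ * (ξ ^ (2 + β))⁻¹ * Real.exp (5 * (C / ξ))) * (((L : ℝ) ^ kk) ^ (-(1 / 4 : ℝ)) + (2 * ((((L ^ kk : ℕ) : ℝ))⁻¹)) ^ β) + ((2 * ((d + 1 : ℕ) : ℝ) + 2) * ((C / ξ ^ 2) ^ 2 * Real.exp (2 * (C / ξ))) + 8 * ((C / ξ) * (C / ξ ^ 2) * Real.exp (2 * (C / ξ))) + 8 * ((C / ξ) * (C / ξ ^ 2) * Real.exp (5 * (C / ξ)))) * (((L : ℝ) ^ kk) ^ (-(1 / 4 : ℝ)) + (2 * ((((L ^ kk : ℕ) : ℝ))⁻¹)) ^ β)) :=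
          mul_le_mul_of_nonneg_left (add_le_add ha hb) hκm
      _ = @basisConst ι _ (Matrix mm mm ℂ) Matrix.frobeniusNormedAddCommGroup Matrix.frobeniusNormedSpace e * Fintype.card mm * ((4 * Cβ * (ξ ^ (2 + β))⁻¹ * Real.exp (5 * (C / ξ))) + ((2 * ((d + 1 : ℕ) : ℝ) + 2) * ((C / ξ ^ 2) ^ 2 * Real.exp (2 * (C / ξ))) + 8 * ((C / ξ) * (C / ξ ^ 2) * Real.exp (2 * (C / ξ))) + 8 * ((C / ξ) * (C / ξ ^ 2) * Real.exp (5 * (C / ξ))))) * (((L : ℝ) ^ kk) ^ (-(1 / 4 : ℝ)) + (2 * ((((L ^ kk : ℕ) : ℝ))⁻¹)) ^ β) := by ring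
  have hD0 : 0 ≤ max D 0 := le_max_right _ _
  have hsum0 : (0 : ℝ) ≤ ((L : ℝ) ^ kk) ^ (-(1 / 4 : ℝ)) + (2 * ((((L ^ kk : ℕ) : ℝ))⁻¹)) ^ β := add_nonneg hx0 hxβ0
  calc D * (((L : ℝ) ^ kk) ^ (-(1 / 4 : ℝ)) + (@basisConst ι _ (Matrix mm mm ℂ) Matrix.frobeniusNormedAddCommGroup Matrix.frobeniusNormedSpace e * (((L ^ r * L ^ kk : ℕ) : ℝ) ^ 2 * (Fintype.card mm * (2 * (((((L ^ r * L ^ kk : ℕ) : ℝ))⁻¹) ^ 2 * ((Cβ * (ξ ^ (2 + β))⁻¹ * (2 * ((L ^ r : ℕ) : ℝ) * ((((L ^ r * L ^ kk : ℕ) : ℝ))⁻¹)) ^ β + 2 * ((((L ^ r * L ^ kk : ℕ) : ℝ))⁻¹) * ((C / ξ) * (C / ξ ^ 2))) * Real.exp (5 * (((((L ^ r * L ^ kk : ℕ) : ℝ))⁻¹) * (C / ξ))))) + ((((L ^ r * L ^ kk : ℕ) : ℝ))⁻¹) ^ 2 * ((C / ξ ^ 2) * Real.exp (((((L ^ r *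 L ^ kk : ℕ) : ℝ))⁻¹) * (C / ξ))) * (((d + 1 : ℕ) : ℝ) * (((L ^ r - 1 : ℕ) : ℝ) * (((((L ^ r * L ^ kk : ℕ) : ℝ))⁻¹) ^ 2 * ((C / ξ ^ 2) * Real.exp (((((L ^ r * L ^ kk : ℕ) : ℝ))⁻¹) * (C / ξ)))))) + (((((L ^ r * L ^ kk : ℕ) : ℝ))⁻¹) ^ 2 * ((C / ξ ^ 2) * Real.exp (((((L ^ r * L ^ kk : ℕ) : ℝ))⁻¹) * (C / ξ))) + (((d + 1 : ℕ) : ℝ) * (((L ^ r - 1 : ℕ) : ℝ) * (((((L ^ r * L ^ kk : ℕ) : ℝ))⁻¹) ^ 2 * ((C / ξ ^ 2) * Real.exp (((((L ^ r * L ^ kk : ℕ) : ℝ))⁻¹) * (C / ξ)))))) + ((((L ^ r * L ^ kk : ℕ) : ℝ))⁻¹) ^ 2 * ((C / ξ ^ 2) * Real.exp (((((L ^ r * L ^ kk : ℕ) : ℝ))⁻¹) * (C / ξ)))) * (((((L ^ r * L ^ kk : ℕ) : ℝ))⁻¹) ^ 2 * ((C / ξ ^ 2) * Real.exp (((((L ^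 r * L ^ kk : ℕ) : ℝ))⁻¹) * (C / ξ)))))) + Fintype.card mm * (2 * ((L ^ kk : ℕ) : ℝ) ^ 2 * (2 * ((L ^ r : ℕ) : ℝ) ^ 3 * ((((((L ^ r * L ^ kk : ℕ) : ℝ))⁻¹) * ((C / ξ) * Real.exp (((((L ^ r * L ^ kk : ℕ) : ℝ))⁻¹) * (C / ξ)))) * (((((L ^ r * L ^ kk : ℕ) : ℝ))⁻¹) ^ 2 * ((C / ξ ^ 2) * Real.exp (((((L ^ r * L ^ kk : ℕ) : ℝ))⁻¹) * (C / ξ))))) + ((L ^ r : ℕ) : ℝ) ^ 2 * (((((L ^ r * L ^ kk : ℕ) : ℝ))⁻¹) ^ 2 * ((Cβ * (ξ ^ (2 + β))⁻¹ * (2 * ((L ^ r : ℕ) : ℝ) * ((((L ^ r * L ^ kk : ℕ) : ℝ))⁻¹)) ^ β + 2 * ((((L ^ r * L ^ kk : ℕ) : ℝ))⁻¹) * ((C / ξ) * (C / ξ ^ 2))) * Real.exp (5 * (((((L ^ r * L ^ kk : ℕ) : ℝ))⁻¹) * (C / ξ)))))) + 2 * (((L ^ r : ℕ) : ℝ) *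 ((L ^ kk : ℕ) : ℝ)) ^ 2 * ((((L ^ r : ℕ) : ℝ) + 1) * (((((L ^ r * L ^ kk : ℕ) : ℝ))⁻¹) * ((C / ξ) * Real.exp (((((L ^ r * L ^ kk : ℕ) : ℝ))⁻¹) * (C / ξ)))) * (((((L ^ r * L ^ kk : ℕ) : ℝ))⁻¹) ^ 2 * ((C / ξ ^ 2) * Real.exp (((((L ^ r * L ^ kk : ℕ) : ℝ))⁻¹) * (C / ξ))))))))) * Real.exp (-(δ / 16 * (unitTorusGeo L kk (cvM d L mv kk hL)).dist y y'))
      ≤ max D 0 * (((L : ℝ) ^ kk) ^ (-(1 / 4 : ℝ)) + (@basisConst ι _ (Matrix mm mm ℂ) Matrix.frobeniusNormedAddCommGroup Matrix.frobeniusNormedSpace e * (((L ^ r * L ^ kk : ℕ) : ℝ) ^ 2 * (Fintype.card mm * (2 * (((((L ^ r * L ^ kk : ℕ) : ℝ))⁻¹) ^ 2 * ((Cβ * (ξ ^ (2 + β))⁻¹ * (2 * ((L ^ r : ℕ) : ℝ) * ((((L ^ r * L ^ kk : ℕ) : ℝ))⁻¹)) ^ β + 2 * ((((L ^ r * L ^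 kk : ℕ) : ℝ))⁻¹) * ((C / ξ) * (C / ξ ^ 2))) * Real.exp (5 * (((((L ^ r * L ^ kk : ℕ) : ℝ))⁻¹) * (C / ξ))))) + ((((L ^ r * L ^ kk : ℕ) : ℝ))⁻¹) ^ 2 * ((C / ξ ^ 2) * Real.exp (((((L ^ r * L ^ kk : ℕ) : ℝ))⁻¹) * (C / ξ))) * (((d + 1 : ℕ) : ℝ) * (((L ^ r - 1 : ℕ) : ℝ) * (((((L ^ r * L ^ kk : ℕ) : ℝ))⁻¹) ^ 2 * ((C / ξ ^ 2) * Real.exp (((((L ^ r * L ^ kk : ℕ) : ℝ))⁻¹) * (C / ξ)))))) + (((((L ^ r * L ^ kk : ℕ) : ℝ))⁻¹) ^ 2 * ((C / ξ ^ 2) * Real.exp (((((L ^ r * L ^ kk : ℕ) : ℝ))⁻¹) * (C / ξ))) + (((d + 1 : ℕ) : ℝ) * (((L ^ r - 1 : ℕ) : ℝ) * (((((L ^ r * L ^ kk : ℕ) : ℝ))⁻¹) ^ 2 * ((C / ξ ^ 2) * Real.exp (((((L ^ r * L ^ kk : ℕ) : ℝ))⁻¹) * (C / ξ)))))) + ((((L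 ^ r * L ^ kk : ℕ) : ℝ))⁻¹) ^ 2 * ((C / ξ ^ 2) * Real.exp (((((L ^ r * L ^ kk : ℕ) : ℝ))⁻¹) * (C / ξ)))) * (((((L ^ r * L ^ kk : ℕ) : ℝ))⁻¹) ^ 2 * ((C / ξ ^ 2) * Real.exp (((((L ^ r * L ^ kk : ℕ) : ℝ))⁻¹) * (C / ξ)))))) + Fintype.card mm * (2 * ((L ^ kk : ℕ) : ℝ) ^ 2 * (2 * ((L ^ r : ℕ) : ℝ) ^ 3 * ((((((L ^ r * L ^ kk : ℕ) : ℝ))⁻¹) * ((C / ξ) * Real.exp (((((L ^ r * L ^ kk : ℕ) : ℝ))⁻¹) * (C / ξ)))) * (((((L ^ r * L ^ kk : ℕ) : ℝ))⁻¹) ^ 2 * ((C / ξ ^ 2) * Real.exp (((((L ^ r * L ^ kk : ℕ) : ℝ))⁻¹) * (C / ξ))))) + ((L ^ r : ℕ) : ℝ) ^ 2 * (((((L ^ r * L ^ kk : ℕ) : ℝ))⁻¹) ^ 2 * ((Cβ * (ξ ^ (2 + β))⁻¹ * (2 * ((L ^ r : ℕ) : ℝ) * ((((L ^ r * L ^ kk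 : ℕ) : ℝ))⁻¹)) ^ β + 2 * ((((L ^ r * L ^ kk : ℕ) : ℝ))⁻¹) * ((C / ξ) * (C / ξ ^ 2))) * Real.exp (5 * (((((L ^ r * L ^ kk : ℕ) : ℝ))⁻¹) * (C / ξ)))))) + 2 * (((L ^ r : ℕ) : ℝ) * ((L ^ kk : ℕ) : ℝ)) ^ 2 * ((((L ^ r : ℕ) : ℝ) + 1) * (((((L ^ r * L ^ kk : ℕ) : ℝ))⁻¹) * ((C / ξ) * Real.exp (((((L ^ r * L ^ kk : ℕ) : ℝ))⁻¹) * (C / ξ)))) * (((((L ^ r * L ^ kk : ℕ) : ℝ))⁻¹) ^ 2 * ((C / ξ ^ 2) * Real.exp (((((L ^ r * L ^ kk : ℕ) : ℝ))⁻¹) * (C / ξ))))))))) * Real.exp (-(δ / 16 * (unitTorusGeo L kk (cvM d L mv kk hL)).dist y y')) :=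
        mul_le_mul_of_nonneg_right (mul_le_mul_of_nonneg_right (le_max_left _ _) (add_nonneg hx0 hoB0)) (Real.exp_pos _).le
    _ ≤ max D 0 * ((((L : ℝ) ^ kk) ^ (-(1 / 4 : ℝ)) + (2 * ((((L ^ kk : ℕ) : ℝ))⁻¹)) ^ β) + @basisConst ι _ (Matrix mm mm ℂ) Matrix.frobeniusNormedAddCommGroup Matrix.frobeniusNormedSpace e * Fintype.card mm * ((4 * Cβ * (ξ ^ (2 + β))⁻¹ * Real.exp (5 * (C / ξ))) + ((2 * ((d + 1 : ℕ) : ℝ) + 2) * ((C / ξ ^ 2) ^ 2 * Real.exp (2 * (C / ξ))) + 8 * ((C / ξ) * (C / ξ ^ 2) * Real.exp (2 * (C / ξ))) + 8 * ((C / ξ) * (C / ξ ^ 2) * Real.exp (5 * (C / ξ))))) * (((L : ℝ) ^ kk) ^ (-(1 / 4 : ℝ)) + (2 * ((((L ^ kk : ℕ) : ℝ))⁻¹)) ^ β)) * Real.exp (-(δ / 16 * (unitTorusGeo L kk (cvM d L mv kk hL)).dist y y')) :=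
        mul_le_mul_of_nonneg_right (mul_le_mul_of_nonneg_left (add_le_add (le_add_of_nonneg_right hxβ0) h2) hD0) (Real.exp_pos _).le
    _ = max D 0 * (1 + @basisConst ι _ (Matrix mm mm ℂ) Matrix.frobeniusNormedAddCommGroup Matrix.frobeniusNormedSpace e * Fintype.card mm * ((4 * Cβ * (ξ ^ (2 + β))⁻¹ * Real.exp (5 * (C / ξ))) + ((2 * ((d + 1 : ℕ) : ℝ) + 2) * ((C / ξ ^ 2) ^ 2 * Real.exp (2 * (C / ξ))) + 8 * ((C / ξ) * (C / ξ ^ 2) * Real.exp (2 * (C / ξ))) + 8 * ((C / ξ) * (C / ξ ^ 2) * Real.exp (5 * (C / ξ)))))) * (((L : ℝ) ^ kk) ^ (-(1 / 4 : ℝ)) + (2 * ((((L ^ kk : ℕ) : ℝ))⁻¹)) ^ β) * Real.exp (-(δ / 16 * (unitTorusGeo L kk (cvM d L mv kk hL)).dist y y')) := by ring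

/-! ## §3 On the printed class: [B11] Thm 1 (9)–(10) per cube AS TYPED -/

set_option maxHeartbeats 800000 in
/-- ★★★★ **THE (PC-E) RATE ON THE PRINTED PER-CUBE REGULARITY CLASS, UNIFORM IN THE FINE SPACING** — dag-n07-a's `B11Reg910Classes.Reg910Cube` ([Balaban1985Variational] Thm 1 (9)–(10) on
one cube, AS TYPED: (3.35), the Hölder clause for `0 ≤ β ≤ β₀`, (10)) per cube on the radius-5 collars, read with the η′-scale fine torus distance, any `β₀ ≥ 0`, `C₄ ≥ 0` ⟹ the two-grid
η-defect of the glued scalar covariant Green's functions is `≤ D(1 + κ_e|m|(R₁ + R₂))·(L^{−k∕4} + (2L^{−k})^{β₀})·e^{−(δ∕16)dist}` with `R₁ = 4C₄ξ^{−(2+β₀)}e^{5C∕ξ}` — the SAME constants for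
every fine spacing `η′ = L^{−r}η`, `r ≥ 1` (n15-c∕370 `Reg910Cube.reg335HolderCube` at `β = β₀` + §2).  Contrast n15-c∕367 + 364: there the class entered through the Lipschitz constant
`C₁ = C₄(ξ∕η′)^{1−β₀}`, i.e. with a rate `∝ L^{r(1−β₀)}`. [cite: Balaban1985Variational, Thm 1 (9)–(10) p.279; Balaban1985RegularSpaces, Thm 2 (1.36) p.82; Balaban1985BackgroundPropagators,
(3.35) p.396, (3.40) p.397 (shapes); King1986, Lemma 4.5 (4.38) p.674 (A = 0 template, uniform in n)] -/
theorem uN_idef_scGreen_tr_of_reg910_rate (hL : Odd L ∧ 1 < L) (hL7 : 7 ≤ L) {a₀ : ℝ} (ha₀ : 0 < a₀) (ι : Type) [Fintype ι] [DecidableEq ι] :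
    ∃ δ w₀ c₀ D : ℝ, 0 < δ ∧ 0 < c₀ ∧ 0 ≤ D ∧ ∀ (mv kk r : ℕ), 1 ≤ kk → 1 ≤ r → w₀ ≤ ((L ^ mv : ℕ) : ℝ) →
      ∀ {mm : Type} [Fintype mm] [DecidableEq mm] [Nonempty mm] (e : Matrix mm mm ℂ ≃L[ℝ] (ι → ℝ)), (∀ A B : Matrix mm mm ℂ, traceForm A B = e A ⬝ᵥ e B) →
      ∀ (U' : Fin (d + 1) → ScX' d L mv kk r hL → (Matrix mm mm ℂ)ˣ), (∀ μ x', (U' μ x' : Matrix mm mm ℂ) ∈ Matrix.unitaryGroup mm ℂ) →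
      ∀ (Q : (Fin (d + 1) → ZMod (2 * L)) → Set (ScX' d L mv kk r hL)) (ξ C β₀ C₄ : ℝ), 0 < ξ → 0 ≤ C → 0 ≤ β₀ → 0 ≤ C₄ →
        (1 + @basisConst ι _ (Matrix mm mm ℂ) Matrix.frobeniusNormedAddCommGroup Matrix.frobeniusNormedSpace e * (2 * Real.sqrt (Fintype.card mm)) * Real.sqrt (Fintype.card mm)) ^ 2 * (C / ξ + C / ξ ^ 2) ≤ c₀ →
        -- [B11] Thm 1 (9)–(10) per cube AS TYPED (dag-n07-a), η′-scale fine torus distance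
        (∀ k, B11Reg910Classes.Reg910Cube (scShift' d L mv kk r hL) U' ((((L ^ r * L ^ kk : ℕ) : ℝ))⁻¹) (Q k) ξ (fun z z' => ((((L ^ r * L ^ kk : ℕ) : ℝ))⁻¹) * tdistT (fine (L ^ r * L ^ kk) (cvM d L mv kk hL)) z z') C C₄ β₀) →
        (∀ k z, (∃ y ∈ cvSk d L mv kk hL k, (unitTorusGeo L kk (cvM d L mv kk hL)).dist (scBlk' d L mv kk r hL z) y ≤ 5) → z ∈ Q k) →
      ∃ u' : (Fin (d + 1) → ZMod (2 * L)) → ScX' d L mv kk r hL → Matrix mm mm ℂ, (∀ k x', (u' k x')ᴴ * u' k x' = 1) ∧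
       (
        HasMaj (ScNorm d L mv kk hL ι) (BlockNorm.ofBlocks (unitTorusGeo L kk (cvM d L mv kk hL)) (liftBlk (scBlk d L mv kk hL ∘ kingPr L kk r (cvM d L mv kk hL)) ι))
          (idef (ctauS (cvM d L mv kk hL) L kk r (fun μ x' => coordMat e (ContinuousLinearMap.mulLeftRight ℝ (Matrix mm mm ℂ) ((U' μ x' : Matrix mm mm ℂ)) ((U' μ x' : Matrix mm mm ℂ))ᴴ))) (ctauS (cvM d L mv kk hL) L kk r (fun μ x' => coordMat e (ContinuousLinearMap.mulLeftRight ℝ (Matrix mm mm ℂ) ((U' μ x' : Matrix mm mm ℂ)) ((U' μ x' : Matrix mm mm ℂ))ᴴ))) (scGlued' d L mv kk r hL (aK a₀ (L : ℝ) (r + kk) * (((L ^ r * L ^ kk : ℕ) : ℝ)) ^ (d + 1)) ((((L ^ r * L ^ kk : ℕ) : ℝ))⁻¹) ι e u' (fun μ z => (U' μ z : Matrix mm mm ℂ)) (scP' d L mv kk r hL (aK a₀ (L : ℝ) (r + kk) * (((L ^ r * L ^ kk : ℕ) : ℝ)) ^ (d + 1)) ι e (fun μ z => (U' μ z : Matrix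 mm mm ℂ))) (scNV' d L mv kk r hL (aK a₀ (L : ℝ) (r + kk) * (((L ^ r * L ^ kk : ℕ) : ℝ)) ^ (d + 1)) ι e u' (fun μ z => (U' μ z : Matrix mm mm ℂ)))) (scGlued d L mv kk hL (aK a₀ (L : ℝ) kk * (((L ^ kk : ℕ) : ℝ)) ^ (d + 1)) ((((L ^ kk : ℕ) : ℝ))⁻¹) ι e (fun k x => u' k (kingSec (cvM d L mv kk hL) L kk r x)) (fun μ y => mprod (fun t => (U' μ (kingSec (cvM d L mv kk hL) L kk r y + t • unitVec (fine (L ^ r * L ^ kk) (cvM d L mv kk hL)) μ) : Matrix mm mm ℂ)) (L ^ r)) (scP d L mv kk hL (aK a₀ (L : ℝ) kk * (((L ^ kk : ℕ) : ℝ)) ^ (d + 1)) ι e (fun μ y => mprod (fun t => (U' μ (kingSec (cvM d L mv kk hL) L kk r y + t • unitVec (fine (L ^ r * L ^ kk) (cvM d L mv kk hL)) μ) : Matrix mm mm ℂ)) (L ^ r))) (scNV d L mv kk hL (aK a₀ (L : ℝ) kk * (((L ^ kk : ℕ) : ℝ)) ^ (d + 1)) ι e (fun k x => u' k (kingSec (cvM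 d L mv kk hL) L kk r x)) (fun μ y => mprod (fun t => (U' μ (kingSec (cvM d L mv kk hL) L kk r y + t • unitVec (fine (L ^ r * L ^ kk) (cvM d L mv kk hL)) μ) : Matrix mm mm ℂ)) (L ^ r)))))
          (fun y y' => D * (1 + @basisConst ι _ (Matrix mm mm ℂ) Matrix.frobeniusNormedAddCommGroup Matrix.frobeniusNormedSpace e * Fintype.card mm * ((4 * C₄ * (ξ ^ (2 + β₀))⁻¹ * Real.exp (5 * (C / ξ))) + ((2 * ((d + 1 : ℕ) : ℝ) + 2) * ((C / ξ ^ 2) ^ 2 * Real.exp (2 * (C / ξ))) + 8 * ((C / ξ) * (C / ξ ^ 2) * Real.exp (2 * (C / ξ))) + 8 * ((C / ξ) * (C / ξ ^ 2) * Real.exp (5 * (C / ξ)))))) * (((L : ℝ) ^ kk) ^ (-(1 / 4 : ℝ)) + (2 * ((((L ^ kk : ℕ) : ℝ))⁻¹)) ^ β₀) * Real.exp (-(δ / 16 * (unitTorusGeo L kk (cvM d L mv kk hL)).dist y y')))) := by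
  obtain ⟨δ, w₀, c₀, D, hδ, hc₀, hD, H⟩ := uN_idef_scGreen_tr_of_reg335Holder_rate (d := d) hL hL7 ha₀ ι
  refine ⟨δ, w₀, c₀, D, hδ, hc₀, hD, fun mv kk r hk hr hw₀ => ?_⟩
  intro mm _ _ _ e he U' hU'g Q ξ C β₀ C₄ hξ hC hβ₀ hC₄ hsmall h910 hQ
  exact H mv kk r hk hr hw₀ e he U' hU'g Q ξ C β₀ C₄ hξ hC hβ₀ hC₄ hsmall (fun k => (h910 k).reg335HolderCube (scShift' d L mv kk r hL) U' hβ₀ le_rfl) hQ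

end Rate

end Summit.QuantumFields.YangMills.BalabanUVNodes.N15.Gluing

end
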